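import Mathlib
import HarnessLib
import Summits.AtomisticToContinuum.HydrodynamicLimit.Theorems.MourreKoopmanChargesOneBodyCompletenessTorusStatics
import Summits.AtomisticToContinuum.HydrodynamicLimit.Theorems.AntiMazurCoboundariesVarianceCertificate
import Literature.MathematicalPhysics.KineticTheory.HardSphereWindowPressureStatic

/-!
# `OneBodyCompleteness` · line `torus_fejer` (v2), stub `stub_testFunctionDensityAll`, part A:
# the window-variance seminorm of the one-body field and its linearity in the test function

First support file (of two) for the registered stub `stub_testFunctionDensityAll` of the skeleton
`Cruxes/OneBodyCompleteness/Lines/torus_fejer.lean` of the crux item stmt-AtomisticToContinuum-9583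
(`OneBodyCompleteness`, route `MourreKoopmanCharges` of `AtomisticToContinuum/HydrodynamicLimit`).

Setting: `N + 1` hard spheres of diameter `hsDiameter σ N` on `𝕋³` under the canonical law
`G = localGibbsLaw σ 1 0 θ N Φ` (`0 < σ < 1/2`, `0 < θ`), a bounded continuous velocity profile `g`
with `∫ g M_θ = 0`, and for a test function `χ` on `𝕋³` the one-body empirical field
`A_χ(z) = ∫ χ(y.1) g(y.2) d(empiricalMeasure z)` (notation `𝔸[χ, g, z]`) and the window-variance
functionals `E_G[(T⁻¹ ∫₀ᵀ A_χ(Φ_s z) ds)²]` (plain windows) and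
`wF[σ, θ, g, Φ, χ, T, N] = E_{G_N}[(T⁻¹ ∫₀ᵀ A_χ((Φ N)_{s (N+1)^{-1/3}} z) ds)²]` (the rescaled windows
of the line), all as lower integrals of `ENNReal.ofReal` of squares.

* SEMINORM (`lintegral_window_le_static`, `wF_le_static`): for EVERY window `T > 0`, every `N` and
  every continuous `ψ` with `|ψ| ≤ η`, `E[(T⁻¹ ∫₀ᵀ A_ψ∘Φ_s)²] ≤ η² (∫ g² M_θ)/(N+1)` — Cauchy–Schwarz
  in time on good orbits, Tonelli + invariance of `G`
  (`AntiMazurCoboundariesVarianceCertificate.lintegral_ofReal_window`) and the exact statics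
  `(N+1) E[A_ψ²] = (∫ ψ²)(∫ g² M_θ)` (`torusStaticVariance`), `∫ ψ² ≤ η²` (`vol 𝕋³ = 1`);
* LINEARITY (`lintegral_window_lincomb_le`, `wF_lincomb_le`): `A_{aψ₁+bψ₂} = a A_{ψ₁} + b A_{ψ₂}`,
  additivity of the time integral on good orbits and `(x+y)² ≤ 2x² + 2y²` give
  `F(aψ₁+bψ₂) ≤ 2a² F(ψ₁) + 2b² F(ψ₂)` in the `∫⁻ ofReal` currency;
* `window_rescale`: `s ↦ s (N+1)^{-1/3}` turns the rescaled window into a plain one.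

References: H. Spohn, *Large Scale Dynamics of Interacting Particles* (1991), Part II §7.1.
Folklore otherwise.
-/

noncomputable section

namespace Summit.AtomisticToContinuum.HydrodynamicLimit.Theorems.MourreKoopmanChargesOneBodyCompleteness

open MeasureTheory ProbabilityTheory Filter Topology Set
open scoped ENNReal BigOperators
open Literature.Analysis.FluidPDE Literature.MathematicalPhysics.KineticTheory
open Summit.AtomisticToContinuum.HydrodynamicLimit.Theorems.MourreKoopmanChargesIdealGasNoDecay
open UnitAddTorus

namespace stub_testFunctionDensityAllAux

/-! ### Notation: the one-body field and the rescaled window functional -/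

/-- `𝔸[χ, h, z]`: the one-body empirical field `A_χ(z) = ∫ χ(y.1) h(y.2) d(empiricalMeasure z)` of a
test function `χ` on `𝕋³` and a velocity profile `h` (scoped notation of this stub's namespace;
`= n⁻¹ Σᵢ χ(xᵢ) h(vᵢ)`, `oneBodyField_eq_sum`). [folklore] -/
scoped notation3 (prettyPrint := false) "𝔸[" χ ", " h ", " z "]" =>
  ∫ y, χ y.1 * h y.2 ∂(Literature.Analysis.FluidPDE.empiricalMeasure z)

/-- `wF[σ, θ, g, Φ, χ, T, N]`: the rescaled window-variance (Fejér) functional of the line,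
`E_{G_N}[(T⁻¹ ∫₀ᵀ A_χ((Φ N)_{s (N+1)^{-1/3}} z) ds)²]` as a lower integral against the canonical law
`G_N = localGibbsLaw σ 1 0 θ N (Φ N)` (scoped notation of this stub's namespace; it unfolds
syntactically to the expression displayed in the stub). [folklore] -/
scoped notation3 (prettyPrint := false)
    "wF[" σ ", " θ ", " g ", " Φ ", " χ ", " T ", " N "]" =>
  ∫⁻ z, ENNReal.ofReal ((T⁻¹ * ∫ s in (0 : ℝ)..T,
      ∫ y, χ y.1 * g y.2 ∂(Literature.Analysis.FluidPDE.empiricalMeasure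
        ((Φ N).flow (s * ((N : ℝ) + 1) ^ (-(1 / 3 : ℝ))) z))) ^ 2)
    ∂(Literature.MathematicalPhysics.KineticTheory.localGibbsLaw σ (fun _ => 1) (fun _ => 0)
      (fun _ => θ) N (Φ N))

/-! ### The one-body empirical field `A_χ` -/

variable {n : ℕ}

/-- The one-body field is measurable in the configuration (continuous `χ`, `h`). [folklore] -/
theorem measurable_field {χ : T3 → ℝ} (hχ : Continuous χ) {h : V3 → ℝ} (hh : Continuous h) :
    Measurable fun z : Config n (Fin 3) T3 => 𝔸[χ, h, z] :=
  measurable_oneBodyField hχ hh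

/-- The one-body field is continuous in the configuration (continuous `χ`, `h`). [folklore] -/
theorem continuous_field {χ : T3 → ℝ} (hχ : Continuous χ) {h : V3 → ℝ} (hh : Continuous h) :
    Continuous fun z : Config n (Fin 3) T3 => 𝔸[χ, h, z] := by
  have e : (fun z : Config n (Fin 3) T3 => 𝔸[χ, h, z]) =
      fun z => (n : ℝ)⁻¹ * ∑ i, χ (z i).1 * h (z i).2 :=
    funext fun z => oneBodyField_eq_sum χ h z
  rw [e]
  exact continuous_const.mul (continuous_finsetSum _ fun i _ =>
    (hχ.comp (continuous_fst.comp (continuous_apply i))).mul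
      (hh.comp (continuous_snd.comp (continuous_apply i))))

/-- The one-body field is linear in the test function. [folklore] -/
theorem field_lincomb {ψ ψ₁ ψ₂ : T3 → ℝ} {a b : ℝ} (hψ : ∀ x, ψ x = a * ψ₁ x + b * ψ₂ x)
    (h : V3 → ℝ) (z : Config n (Fin 3) T3) :
    𝔸[ψ, h, z] = a * 𝔸[ψ₁, h, z] + b * 𝔸[ψ₂, h, z] := by
  rw [oneBodyField_eq_sum ψ h z, oneBodyField_eq_sum ψ₁ h z, oneBodyField_eq_sum ψ₂ h z]
  simp only [hψ, add_mul, Finset.sum_add_distrib, mul_assoc, ← Finset.mul_sum]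
  ring

/-- `|A_χ(z)| ≤ C_χ K` for `|χ| ≤ C_χ`, `|h| ≤ K` (an average of `N + 1` such products). [folklore] -/
theorem abs_field_le {N : ℕ} {χ : T3 → ℝ} {Cχ : ℝ} (hCχ : ∀ x, |χ x| ≤ Cχ) {h : V3 → ℝ} {K : ℝ}
    (hK : ∀ v, |h v| ≤ K) (z : Config (N + 1) (Fin 3) T3) : |𝔸[χ, h, z]| ≤ Cχ * K := by
  rw [oneBodyField_eq_sum, abs_mul, abs_inv, Nat.abs_cast]
  have hs : |∑ i, χ (z i).1 * h (z i).2| ≤ ∑ _i : Fin (N + 1), Cχ * K :=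
    (Finset.abs_sum_le_sum_abs _ _).trans (Finset.sum_le_sum fun i _ => by
      rw [abs_mul]
      exact mul_le_mul (hCχ (z i).1) (hK (z i).2) (abs_nonneg _)
        ((abs_nonneg (χ (z i).1)).trans (hCχ (z i).1)))
  rw [Finset.sum_const, Finset.card_univ, Fintype.card_fin, nsmul_eq_mul] at hs
  have hN : (0 : ℝ) < ((N + 1 : ℕ) : ℝ) := by positivity
  calc ((N + 1 : ℕ) : ℝ)⁻¹ * |∑ i, χ (z i).1 * h (z i).2|
      ≤ ((N + 1 : ℕ) : ℝ)⁻¹ * (((N + 1 : ℕ) : ℝ) * (Cχ * K)) := by gcongr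
    _ = Cχ * K := by rw [← mul_assoc, inv_mul_cancel₀ hN.ne', one_mul]

/-! ### Plain window functionals under the canonical law -/

variable {σ θ : ℝ} {N : ℕ}

/-- **Exact static second moment**: `E_G[A_ψ²] = (∫ ψ²)(∫ g² M_θ)/(N+1)` for bounded continuous
mean-zero `g` and continuous `ψ` (`torusStaticVariance` with `Φ_0 = id` a.e.). [folklore] -/
theorem integral_sq_field (hσ : 0 < σ) (hσ2 : σ < 1 / 2) (hθ : 0 < θ)
    (Φ : HardSphereFlow (Torus.geometry (Fin 3)) (hsDiameter σ N) (N + 1))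
    {g : V3 → ℝ} (hg : Continuous g) {K : ℝ} (hK : ∀ v, |g v| ≤ K)
    (hg0 : ∫ v, g v * localMaxwellian 1 θ (0 : V3) v = 0) {ψ : T3 → ℝ} (hψ : Continuous ψ) :
    ∫ z, 𝔸[ψ, g, z] ^ 2 ∂(localGibbsLaw σ (fun _ => 1) (fun _ => 0) (fun _ => θ) N Φ) =
      (∫ x, ψ x * ψ x) * (∫ v, g v ^ 2 * localMaxwellian 1 θ (0 : V3) v) / ((N : ℝ) + 1) := by
  have hCk : ∀ v, |g v| ≤ K * (1 + ‖v‖) ^ 0 := fun v => by rw [pow_zero, mul_one]; exact hK v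
  have h : ((N : ℝ) + 1) * ∫ z, 𝔸[ψ, g, Φ.flow 0 z] * 𝔸[ψ, g, z]
        ∂(localGibbsLaw σ (fun _ => 1) (fun _ => 0) (fun _ => θ) N Φ) =
      (∫ x, ψ x * ψ x) * ∫ v, g v ^ 2 * localMaxwellian 1 θ (0 : V3) v :=
    torusStaticVariance σ hσ hσ2 θ hθ g hg ⟨K, 0, hCk⟩ hg0 N Φ ψ hψ
  have h0 : ∫ z, 𝔸[ψ, g, Φ.flow 0 z] * 𝔸[ψ, g, z]
        ∂(localGibbsLaw σ (fun _ => 1) (fun _ => 0) (fun _ => θ) N Φ) =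
      ∫ z, 𝔸[ψ, g, z] ^ 2 ∂(localGibbsLaw σ (fun _ => 1) (fun _ => 0) (fun _ => θ) N Φ) := by
    refine integral_congr_ae ?_
    filter_upwards [ae_mem_good_localGibbsLaw σ (fun _ => 1) (fun _ => 0) (fun _ => θ) N Φ]
      with z hz
    rw [Φ.flow_zero z hz, sq]
  rw [h0] at h
  rw [eq_div_iff (by positivity)]
  linarith

/-- **Seminorm bound at every window** (plain windows): for `T > 0`, continuous `ψ` with `|ψ| ≤ η`
and bounded continuous mean-zero `g`,
`E_G[(T⁻¹ ∫₀ᵀ A_ψ(Φ_s z) ds)²] ≤ η² (∫ g² M_θ)/(N+1)` — Cauchy–Schwarz in time on good orbits,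
Tonelli + invariance, and the exact statics. [folklore] -/
theorem lintegral_window_le_static (hσ : 0 < σ) (hσ2 : σ < 1 / 2) (hθ : 0 < θ)
    (Φ : HardSphereFlow (Torus.geometry (Fin 3)) (hsDiameter σ N) (N + 1))
    {g : V3 → ℝ} (hg : Continuous g) {K : ℝ} (hK : ∀ v, |g v| ≤ K)
    (hg0 : ∫ v, g v * localMaxwellian 1 θ (0 : V3) v = 0)
    {ψ : T3 → ℝ} (hψ : Continuous ψ) {η : ℝ} (hη : ∀ x, |ψ x| ≤ η) {T : ℝ} (hT : 0 < T) :
    ∫⁻ z, ENNReal.ofReal ((T⁻¹ * ∫ s in (0 : ℝ)..T, 𝔸[ψ, g, Φ.flow s z]) ^ 2)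
        ∂(localGibbsLaw σ (fun _ => 1) (fun _ => 0) (fun _ => θ) N Φ) ≤
      ENNReal.ofReal (η ^ 2 * (∫ v, g v ^ 2 * localMaxwellian 1 θ (0 : V3) v) / ((N : ℝ) + 1)) := by
  have hAm : Measurable fun w : Config (N + 1) (Fin 3) T3 => 𝔸[ψ, g, w] := measurable_field hψ hg
  have hCA : ∀ w : Config (N + 1) (Fin 3) T3, |𝔸[ψ, g, w]| ≤ η * K := fun w =>
    abs_field_le hη hK w
  have hA2m : Measurable fun w : Config (N + 1) (Fin 3) T3 => 𝔸[ψ, g, w] ^ 2 := hAm.pow_const 2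
  have hCA2 : ∀ w : Config (N + 1) (Fin 3) T3, |𝔸[ψ, g, w] ^ 2| ≤ (η * K) ^ 2 := fun w => by
    rw [abs_pow]; exact pow_le_pow_left₀ (abs_nonneg _) (hCA w) 2
  have hCk : ∀ v, |g v| ≤ K * (1 + ‖v‖) ^ 0 := fun v => by rw [pow_zero, mul_one]; exact hK v
  have hA2 : MemLp (fun w : Config (N + 1) (Fin 3) T3 => 𝔸[ψ, g, w]) 2
      (localGibbsLaw σ (fun _ => 1) (fun _ => 0) (fun _ => θ) N Φ) :=
    memLp_two_oneBodyField_localGibbsLaw_one hθ hσ2.le N Φ hψ hg hCk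
  have hstat := integral_sq_field hσ hσ2 hθ Φ hg hK hg0 hψ
  set G := localGibbsLaw σ (fun _ => 1) (fun _ => 0) (fun _ => θ) N Φ with hG
  haveI : IsProbabilityMeasure G := isProbabilityMeasure_localGibbsLaw_const hθ hσ2.le (0 : V3) N Φ
  have hgood : G Φ.goodᶜ = 0 :=
    mem_ae_iff.1 (ae_mem_good_localGibbsLaw σ (fun _ => 1) (fun _ => 0) (fun _ => θ) N Φ)
  have hinv : ∀ t, MeasurePreserving (Φ.flow t) G G := fun t =>
    measurePreserving_flow_localGibbsLaw_const σ 1 θ 0 N Φ t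
  have hT0 : 0 ≤ T⁻¹ := inv_nonneg.2 hT.le
  have hN1 : (0 : ℝ) < (N : ℝ) + 1 := by positivity
  set M : ℝ := ∫ v, g v ^ 2 * localMaxwellian 1 θ (0 : V3) v with hM
  have hM0 : 0 ≤ M :=
    integral_nonneg fun v => mul_nonneg (sq_nonneg _) (localMaxwellian_nonneg zero_le_one hθ.le _ _)
  -- Cauchy–Schwarz in time, on good orbits
  have hpt : ∀ᵐ z ∂G, ENNReal.ofReal ((T⁻¹ * ∫ s in (0 : ℝ)..T, 𝔸[ψ, g, Φ.flow s z]) ^ 2) ≤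
      ENNReal.ofReal T⁻¹ * ENNReal.ofReal (∫ s in (0 : ℝ)..T, 𝔸[ψ, g, Φ.flow s z] ^ 2) := by
    filter_upwards [ae_mem_good_localGibbsLaw σ (fun _ => 1) (fun _ => 0) (fun _ => θ) N Φ]
      with z hz
    have hcs := AntiMazurCoboundariesVarianceCertificate.sq_integral_le_mul_integral_sq hT.le
      (Φ.intervalIntegrable_comp_flow_of_bounded hz hAm hCA 0 T)
      (Φ.intervalIntegrable_comp_flow_of_bounded hz hA2m hCA2 0 T)
    rw [sub_zero] at hcs
    rw [← ENNReal.ofReal_mul hT0]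
    refine ENNReal.ofReal_le_ofReal ?_
    set X := ∫ s in (0 : ℝ)..T, 𝔸[ψ, g, Φ.flow s z]
    set J := ∫ s in (0 : ℝ)..T, 𝔸[ψ, g, Φ.flow s z] ^ 2
    calc (T⁻¹ * X) ^ 2 = T⁻¹ * (T⁻¹ * X ^ 2) := by ring
      _ ≤ T⁻¹ * (T⁻¹ * (T * J)) := by gcongr
      _ = T⁻¹ * J := by rw [← mul_assoc T⁻¹ T J, inv_mul_cancel₀ hT.ne', one_mul]
  -- the static bound `E[A²] ≤ η² M/(N+1)`
  have hψψ : ∫ x, ψ x * ψ x ≤ η ^ 2 := by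
    have h1 : ∫ x, ψ x * ψ x ≤ ∫ _ : T3, η ^ 2 :=
      integral_mono_of_nonneg (ae_of_all _ fun x => mul_self_nonneg (ψ x)) (integrable_const _)
        (ae_of_all _ fun x => by
          show ψ x * ψ x ≤ η ^ 2
          rw [← sq, ← sq_abs]
          exact pow_le_pow_left₀ (abs_nonneg _) (hη x) 2)
    simpa using h1
  have hreal : ∫ z, 𝔸[ψ, g, z] ^ 2 ∂G ≤ η ^ 2 * M / ((N : ℝ) + 1) := by
    rw [hstat]
    exact div_le_div_of_nonneg_right (mul_le_mul_of_nonneg_right hψψ hM0) hN1.le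
  -- assemble
  calc ∫⁻ z, ENNReal.ofReal ((T⁻¹ * ∫ s in (0 : ℝ)..T, 𝔸[ψ, g, Φ.flow s z]) ^ 2) ∂G
      ≤ ∫⁻ z, ENNReal.ofReal T⁻¹ * ENNReal.ofReal (∫ s in (0 : ℝ)..T, 𝔸[ψ, g, Φ.flow s z] ^ 2) ∂G :=
        lintegral_mono_ae hpt
    _ = ENNReal.ofReal T⁻¹ * (ENNReal.ofReal (T - 0) * ∫⁻ z, ENNReal.ofReal (𝔸[ψ, g, z] ^ 2) ∂G) := by
        rw [lintegral_const_mul' _ _ ENNReal.ofReal_ne_top,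
          AntiMazurCoboundariesVarianceCertificate.lintegral_ofReal_window Φ G hinv hgood hA2m
            (fun w => sq_nonneg _) hCA2 hT.le]
    _ = ∫⁻ z, ENNReal.ofReal (𝔸[ψ, g, z] ^ 2) ∂G := by
        rw [sub_zero, ← mul_assoc, ← ENNReal.ofReal_mul hT0, inv_mul_cancel₀ hT.ne',
          ENNReal.ofReal_one, one_mul]
    _ = ENNReal.ofReal (∫ z, 𝔸[ψ, g, z] ^ 2 ∂G) :=
        (ofReal_integral_eq_lintegral_ofReal hA2.integrable_sq (ae_of_all _ fun z => sq_nonneg _)).symm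
    _ ≤ ENNReal.ofReal (η ^ 2 * M / ((N : ℝ) + 1)) := ENNReal.ofReal_le_ofReal hreal

/-- **Linearity in the test function, in the `∫⁻ ofReal` currency** (plain windows): for
`ψ = a ψ₁ + b ψ₂` pointwise and every window,
`E_G[(T⁻¹∫₀ᵀ A_ψ∘Φ_s)²] ≤ 2a² E_G[(T⁻¹∫₀ᵀ A_{ψ₁}∘Φ_s)²] + 2b² E_G[(T⁻¹∫₀ᵀ A_{ψ₂}∘Φ_s)²]`
(`A_ψ = a A_{ψ₁} + b A_{ψ₂}`, additivity of the time integral on good orbits, `(x+y)² ≤ 2x²+2y²`).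
[folklore] -/
theorem lintegral_window_lincomb_le
    (Φ : HardSphereFlow (Torus.geometry (Fin 3)) (hsDiameter σ N) (N + 1))
    {g : V3 → ℝ} (hg : Continuous g) {ψ ψ₁ ψ₂ : T3 → ℝ} (hψ₁ : Continuous ψ₁)
    (hψ₂ : Continuous ψ₂) {a b : ℝ} (hψ : ∀ x, ψ x = a * ψ₁ x + b * ψ₂ x) (T : ℝ) :
    ∫⁻ z, ENNReal.ofReal ((T⁻¹ * ∫ s in (0 : ℝ)..T, 𝔸[ψ, g, Φ.flow s z]) ^ 2)
        ∂(localGibbsLaw σ (fun _ => 1) (fun _ => 0) (fun _ => θ) N Φ) ≤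
      ENNReal.ofReal (2 * a ^ 2) *
          ∫⁻ z, ENNReal.ofReal ((T⁻¹ * ∫ s in (0 : ℝ)..T, 𝔸[ψ₁, g, Φ.flow s z]) ^ 2)
            ∂(localGibbsLaw σ (fun _ => 1) (fun _ => 0) (fun _ => θ) N Φ) +
        ENNReal.ofReal (2 * b ^ 2) *
          ∫⁻ z, ENNReal.ofReal ((T⁻¹ * ∫ s in (0 : ℝ)..T, 𝔸[ψ₂, g, Φ.flow s z]) ^ 2)
            ∂(localGibbsLaw σ (fun _ => 1) (fun _ => 0) (fun _ => θ) N Φ) := by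
  set G := localGibbsLaw σ (fun _ => 1) (fun _ => 0) (fun _ => θ) N Φ with hG
  have hgood : G Φ.goodᶜ = 0 :=
    mem_ae_iff.1 (ae_mem_good_localGibbsLaw σ (fun _ => 1) (fun _ => 0) (fun _ => θ) N Φ)
  have hA₁c : Continuous fun w : Config (N + 1) (Fin 3) T3 => 𝔸[ψ₁, g, w] :=
    continuous_field hψ₁ hg
  have hA₂c : Continuous fun w : Config (N + 1) (Fin 3) T3 => 𝔸[ψ₂, g, w] :=
    continuous_field hψ₂ hg
  have hpt : ∀ᵐ z ∂G, ENNReal.ofReal ((T⁻¹ * ∫ s in (0 : ℝ)..T, 𝔸[ψ, g, Φ.flow s z]) ^ 2) ≤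
      ENNReal.ofReal (2 * a ^ 2) *
          ENNReal.ofReal ((T⁻¹ * ∫ s in (0 : ℝ)..T, 𝔸[ψ₁, g, Φ.flow s z]) ^ 2) +
        ENNReal.ofReal (2 * b ^ 2) *
          ENNReal.ofReal ((T⁻¹ * ∫ s in (0 : ℝ)..T, 𝔸[ψ₂, g, Φ.flow s z]) ^ 2) := by
    filter_upwards [ae_mem_good_localGibbsLaw σ (fun _ => 1) (fun _ => 0) (fun _ => θ) N Φ]
      with z hz
    have h1 := Φ.intervalIntegrable_comp_flow_of_continuous hz hA₁c 0 T
    have h2 := Φ.intervalIntegrable_comp_flow_of_continuous hz hA₂c 0 T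
    have e : ∫ s in (0 : ℝ)..T, 𝔸[ψ, g, Φ.flow s z] =
        a * (∫ s in (0 : ℝ)..T, 𝔸[ψ₁, g, Φ.flow s z]) +
          b * ∫ s in (0 : ℝ)..T, 𝔸[ψ₂, g, Φ.flow s z] := by
      simp_rw [field_lincomb hψ g]
      rw [intervalIntegral.integral_add (h1.const_mul a) (h2.const_mul b),
        intervalIntegral.integral_const_mul, intervalIntegral.integral_const_mul]
    rw [e]
    set X := ∫ s in (0 : ℝ)..T, 𝔸[ψ₁, g, Φ.flow s z]
    set Y := ∫ s in (0 : ℝ)..T, 𝔸[ψ₂, g, Φ.flow s z]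
    calc ENNReal.ofReal ((T⁻¹ * (a * X + b * Y)) ^ 2)
        ≤ ENNReal.ofReal (2 * a ^ 2 * (T⁻¹ * X) ^ 2 + 2 * b ^ 2 * (T⁻¹ * Y) ^ 2) :=
          ENNReal.ofReal_le_ofReal (by nlinarith [sq_nonneg (a * (T⁻¹ * X) - b * (T⁻¹ * Y))])
      _ ≤ ENNReal.ofReal (2 * a ^ 2 * (T⁻¹ * X) ^ 2) + ENNReal.ofReal (2 * b ^ 2 * (T⁻¹ * Y) ^ 2) :=
          ENNReal.ofReal_add_le
      _ = _ := by
          rw [ENNReal.ofReal_mul (by positivity : (0 : ℝ) ≤ 2 * a ^ 2),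
            ENNReal.ofReal_mul (by positivity : (0 : ℝ) ≤ 2 * b ^ 2)]
  have hm : AEMeasurable (fun z => ENNReal.ofReal (2 * a ^ 2) *
      ENNReal.ofReal ((T⁻¹ * ∫ s in (0 : ℝ)..T, 𝔸[ψ₁, g, Φ.flow s z]) ^ 2)) G :=
    ((((Φ.aemeasurable_intervalIntegral_comp_flow_torus (measurable_field hψ₁ hg) 0 T
      hgood).const_mul T⁻¹).pow_const 2).ennreal_ofReal).const_mul _
  calc ∫⁻ z, ENNReal.ofReal ((T⁻¹ * ∫ s in (0 : ℝ)..T, 𝔸[ψ, g, Φ.flow s z]) ^ 2) ∂G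
      ≤ ∫⁻ z, (ENNReal.ofReal (2 * a ^ 2) *
            ENNReal.ofReal ((T⁻¹ * ∫ s in (0 : ℝ)..T, 𝔸[ψ₁, g, Φ.flow s z]) ^ 2) +
          ENNReal.ofReal (2 * b ^ 2) *
            ENNReal.ofReal ((T⁻¹ * ∫ s in (0 : ℝ)..T, 𝔸[ψ₂, g, Φ.flow s z]) ^ 2)) ∂G :=
        lintegral_mono_ae hpt
    _ = _ := by
        rw [lintegral_add_left' hm, lintegral_const_mul' _ _ ENNReal.ofReal_ne_top,
          lintegral_const_mul' _ _ ENNReal.ofReal_ne_top]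

/-! ### The rescaled window functional of the line -/

/-- Change of variables `s ↦ s (N+1)^{-1/3}`: the rescaled window average of the line is a plain
window average of length `T (N+1)^{-1/3}`. [folklore] -/
theorem window_rescale {ε : ℝ} (ψ : T3 → ℝ) (h : V3 → ℝ)
    (Φ : HardSphereFlow (Torus.geometry (Fin 3)) ε (N + 1)) (z : Config (N + 1) (Fin 3) T3)
    (T : ℝ) :
    T⁻¹ * ∫ s in (0 : ℝ)..T, 𝔸[ψ, h, Φ.flow (s * ((N : ℝ) + 1) ^ (-(1 / 3 : ℝ))) z] =
      (T * ((N : ℝ) + 1) ^ (-(1 / 3 : ℝ)))⁻¹ *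
        ∫ s in (0 : ℝ)..T * ((N : ℝ) + 1) ^ (-(1 / 3 : ℝ)), 𝔸[ψ, h, Φ.flow s z] := by
  have hc : ((N : ℝ) + 1) ^ (-(1 / 3 : ℝ)) ≠ 0 := (Real.rpow_pos_of_pos (by positivity) _).ne'
  rw [intervalIntegral.integral_comp_mul_right (fun s => 𝔸[ψ, h, Φ.flow s z]) hc, zero_mul,
    smul_eq_mul, mul_inv]
  ring

variable {g : V3 → ℝ}
  {Φ : (N : ℕ) → HardSphereFlow (Torus.geometry (Fin 3)) (hsDiameter σ N) (N + 1)}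

/-- Seminorm bound for the rescaled functional: `wF[ψ, T, N] ≤ η² (∫ g² M_θ)/(N+1)` for every
`T > 0`, every `N`, `|ψ| ≤ η`. [folklore] -/
theorem wF_le_static (hσ : 0 < σ) (hσ2 : σ < 1 / 2) (hθ : 0 < θ) (hg : Continuous g) {K : ℝ}
    (hK : ∀ v, |g v| ≤ K) (hg0 : ∫ v, g v * localMaxwellian 1 θ (0 : V3) v = 0)
    {ψ : T3 → ℝ} (hψ : Continuous ψ) {η : ℝ} (hη : ∀ x, |ψ x| ≤ η) {T : ℝ} (hT : 0 < T) (N : ℕ) :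
    wF[σ, θ, g, Φ, ψ, T, N] ≤
      ENNReal.ofReal (η ^ 2 * (∫ v, g v ^ 2 * localMaxwellian 1 θ (0 : V3) v) / ((N : ℝ) + 1)) := by
  simp only [window_rescale ψ g (Φ N)]
  exact lintegral_window_le_static hσ hσ2 hθ (Φ N) hg hK hg0 hψ hη
    (mul_pos hT (Real.rpow_pos_of_pos (by positivity) _))

/-- Linearity bound for the rescaled functional: `wF[aψ₁ + bψ₂] ≤ 2a² wF[ψ₁] + 2b² wF[ψ₂]` at every
window and every `N`. [folklore] -/
theorem wF_lincomb_le (hg : Continuous g) {ψ ψ₁ ψ₂ : T3 → ℝ} (hψ₁ : Continuous ψ₁)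
    (hψ₂ : Continuous ψ₂) {a b : ℝ} (hψ : ∀ x, ψ x = a * ψ₁ x + b * ψ₂ x) (T : ℝ) (N : ℕ) :
    wF[σ, θ, g, Φ, ψ, T, N] ≤
      ENNReal.ofReal (2 * a ^ 2) * wF[σ, θ, g, Φ, ψ₁, T, N] +
        ENNReal.ofReal (2 * b ^ 2) * wF[σ, θ, g, Φ, ψ₂, T, N] := by
  simp only [window_rescale ψ g (Φ N), window_rescale ψ₁ g (Φ N), window_rescale ψ₂ g (Φ N)]
  exact lintegral_window_lincomb_le (Φ N) hg hψ₁ hψ₂ hψ _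

end stub_testFunctionDensityAllAux

end Summit.AtomisticToContinuum.HydrodynamicLimit.Theorems.MourreKoopmanChargesOneBodyCompleteness

end
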